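import Literature.AlgebraicGeometry.Hassett2000.CubicScrollLoci
import HarnessLib

/-!
# HodgeLocusCensusMonomialPairCount — the monomial counts of the all-`n` Fermat standard-pair computation equal the
# Literature parameter counts, for EVERY `k ≥ 1` (cell pub-hlocus, lead gen 7; ivhs-2 GENERIC-EXCESS-g10 §0quater STEPS 2 and 4)
HONEST FRAMING: certified instances and evidence bearing on the general Hodge conjecture; no claim.

In GENERIC-EXCESS-g10 §0quater (ivhs-2, gen 10; read and re-derived by the lead, gen 7) the two annihilator ideals of the standard
Aoki–Shioda pair `P, P̌ ⊂ X_F` (`P ∩ P̌ = ℙ^{k−2}`, cubic `2k`-folds) are monomial, and with `j = k − 1` common slots: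
* STEP 2: `dim V_3 = #{E_S} + #{C_{i,S}, D_{i,S}} + #{A_S, B_S} = C(j,3) + 4·C(j,2) + 2j` (square-free `w`-monomials of degree 3; times `a_i` or
  `b_i` of degree 2; times `a_1a_2` or `b_1b_2` of degree 1) — this number is `codim NL(P,P̌)`;
* STEP 4: `rank (ψ_1 + λψ_2) = C(j,3) + 4·C(j,2) + j` for every `λ ≠ 0` (private columns for the `C, D, E` rows, and the `j` proportional
  row pairs `(A_m, B_m)`), so the first-order excess is `j = k − 1`.
Below, both counts are identified FOR ALL `k` with the closed forms of `Literature/AlgebraicGeometry/Hassett2000/CubicScrollLoci`: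
`planePairLocusCodim k` (cubics containing two `k`-planes meeting in a `ℙ^{k−2}`) and `scrollLocusCodim k` (cubics containing a cubic
`k`-fold scroll, Hilbert-scheme count), whose difference is `k − 1` (`excess_eq`).  So the hand computation's numbers ARE the parameter
counts, identically in `k` — the census values `8, 19, 36, 60, 92` and `6, 16, 32, 55, 86` (`k = 3..7`) being instances.
BOOKKEEPING ONLY (polynomial identities in `k`); nothing is asserted here about ranks of actual IVHS matrices or about Hodge loci.
-/

namespace Summit.HodgeConjecture.HodgeConjecture.HodgeLocus.Census

open Literature.AlgebraicGeometry.Hassett2000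

/-- `j² = 2·C(j,2) + j`. -/
theorem natCast_sq_eq_two_mul_choose_two (j : ℕ) : ((j : ℤ)) ^ 2 = 2 * (j.choose 2 : ℤ) + j := by
  induction j with
  | zero => simp
  | succ n ih =>
    have h : (n + 1).choose 2 = n + n.choose 2 := by
      have := Nat.choose_succ_succ' n 1
      simpa [Nat.choose_one_right] using this
    rw [h]
    push_cast
    linear_combination ih

/-- STEP 2 count = the pair-of-planes parameter count: `codim NL(P,P̌) = C(k−1,3) + 4·C(k−1,2) + 2(k−1)` for every `k ≥ 1`
(`k = j + 1`). -/
theorem planePairLocusCodim_eq_monomialCount (j : ℕ) :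
    planePairLocusCodim (j + 1) = (j.choose 3 : ℤ) + 4 * (j.choose 2 : ℤ) + 2 * j := by
  unfold planePairLocusCodim
  have p1 : (j + 4).choose 3 = (j + 3).choose 2 + (j + 3).choose 3 := Nat.choose_succ_succ' (j + 3) 2
  have p2 : (j + 3).choose 3 = (j + 2).choose 2 + (j + 2).choose 3 := Nat.choose_succ_succ' (j + 2) 2
  have p3 : (j + 2).choose 3 = (j + 1).choose 2 + (j + 1).choose 3 := Nat.choose_succ_succ' (j + 1) 2
  have p4 : (j + 1).choose 3 = j.choose 2 + j.choose 3 := Nat.choose_succ_succ' j 2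
  have q1 : (j + 3).choose 2 = (j + 2).choose 1 + (j + 2).choose 2 := Nat.choose_succ_succ' (j + 2) 1
  have q2 : (j + 2).choose 2 = (j + 1).choose 1 + (j + 1).choose 2 := Nat.choose_succ_succ' (j + 1) 1
  have q3 : (j + 1).choose 2 = j.choose 1 + j.choose 2 := Nat.choose_succ_succ' j 1
  simp only [Nat.choose_one_right] at q1 q2 q3
  have sq := natCast_sq_eq_two_mul_choose_two j
  rw [show j + 1 + 3 = j + 4 from by ring, show j + 1 + 1 = j + 2 from by ring, p1, p2, p3, p4, q1, q2, q3]
  push_cast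
  linear_combination (-1 : ℤ) * sq

/-- STEP 4 rank = the cubic-scroll parameter count: `rank M_{[P]+λ[P̌]}(X_F) = C(k−1,3) + 4·C(k−1,2) + (k−1) = scrollLocusCodim k` for
every `k ≥ 1` (`k = j + 1`; uses `excess_eq`). -/
theorem scrollLocusCodim_eq_monomialRank (j : ℕ) :
    scrollLocusCodim (j + 1) = (j.choose 3 : ℤ) + 4 * (j.choose 2 : ℤ) + j := by
  have h := excess_eq j
  unfold excess at h
  have p := planePairLocusCodim_eq_monomialCount j
  linear_combination p - h

/-- Instances `k = 3,…,8`: `8, 19, 36, 60, 92, 133` and `6, 16, 32, 55, 86, 126` (the census codim NL / rank values for `n = 6..14`, and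
engine K's `k = 8` values). -/
theorem monomialCount_table :
    (planePairLocusCodim 3 = 8 ∧ planePairLocusCodim 4 = 19 ∧ planePairLocusCodim 5 = 36 ∧ planePairLocusCodim 6 = 60 ∧
      planePairLocusCodim 7 = 92 ∧ planePairLocusCodim 8 = 133) ∧
    (scrollLocusCodim 3 = 6 ∧ scrollLocusCodim 4 = 16 ∧ scrollLocusCodim 5 = 32 ∧ scrollLocusCodim 6 = 55 ∧
      scrollLocusCodim 7 = 86 ∧ scrollLocusCodim 8 = 126) := by
  refine ⟨by decide, by decide⟩

end Summit.HodgeConjecture.HodgeConjecture.HodgeLocus.Census
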